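import Mathlib.Algebra.Order.BigOperators.Ring.Finset
import Mathlib.Algebra.BigOperators.Fin
import Mathlib.Data.Real.Basic
import Mathlib.Tactic
import HarnessLib

/-!
# Block psd lifts of the perfect matching polytope (cell pnp-psdrank, rung F-N2.SOC): cell-pair accounting

Abstract GOOD/GARBAGE accounting over cell maps (landing file 1a of 4, pnp-psdrank-eng g4, from the farm-checked
work file HOME/pnp-psdrank-eng/lean/BlockLift.lean v2, sha256/16 01d03dbb37281499, Part A).

Setting: pairs `(x, y)` carry weights `W x y ≤ K x y` (`K ≥ 0`, every rectangle sum of `W` at most `θ₀`) and a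
quantity `d x y` with `d² ≤ 1`; the pairs are grouped into cells `cA x`, `cB y` such that `|d|` is within `e`
of a constant `κ (cA x) (cB y)` on each cell pair. On a GOOD cell pair (`κ ≥ (6/η+1)e`) `d²` is multiplicatively
almost constant and `Σ W d²` is charged `θ₀` (one rectangle) plus `η Σ K d²`; on a GARBAGE cell pair `d² ≤ τ`
pointwise and `Σ W d² ≤ τ Σ K`. Total: `Σ W d² ≤ |BoxA|·|BoxB|·θ₀ + η Σ K d² + τ Σ K` (`cells_bound`). This is
the combinatorial half of the cube-grid net behind the polynomial-in-`b` block bound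
(`SmallBlockRothvossBallGridBound`): every `(S^b_+)^m` psd lift of `P_PM(n)` has `2^{c n/(b+1)} ≤ m · n⁹`.
WHAT THIS IS NOT: no statement about general psd rank (rung F-N2 stays open), nothing P ≠ NP-relevant.
-/

set_option linter.dupNamespace false -- `Summit.PneNP.PneNP.…`: summit = sub-problem (D-0017)

noncomputable section

open Finset Real

namespace Summit.PneNP.PneNP.Theorems.SmallBlockRothvossBallGrid

section Cells

variable {α β γ γ' : Type*} [Fintype α] [Fintype β] [DecidableEq γ] [DecidableEq γ']

/-- The constants of a good cell pair: if `(6/η + 1)·e ≤ κ`, `0 < η ≤ 1`, `0 ≤ e`, then `e ≤ κ` and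
`(κ + e)² ≤ (1 + η)(κ − e)²`. -/
theorem good_cell {κ e η : ℝ} (hη : 0 < η) (hη1 : η ≤ 1) (he : 0 ≤ e)
    (hgood : (6 / η + 1) * e ≤ κ) : 0 ≤ κ - e ∧ (κ + e) ^ 2 ≤ (1 + η) * (κ - e) ^ 2 := by
  refine ⟨?_, ?_⟩
  · have : e ≤ (6 / η + 1) * e := by
      have h6 : 0 ≤ 6 / η * e := by positivity
      nlinarith
    linarith
  set u := κ - e with hu
  have hu6 : 6 * e ≤ η * u := by
    have : (6 / η + 1) * e = 6 / η * e + e := by ring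
    rw [this] at hgood
    have h' : 6 / η * e ≤ u := by linarith
    have := mul_le_mul_of_nonneg_left h' hη.le
    rwa [← mul_assoc, mul_div_cancel₀ _ hη.ne'] at this
  have hu2 : 2 * e ≤ u := by nlinarith
  have hu0 : 0 ≤ u := by linarith
  have hk : κ + e = u + 2 * e := by rw [hu]; ring
  rw [hk]
  nlinarith [mul_nonneg hu0 he, mul_nonneg hη.le (mul_nonneg hu0 hu0)]

/-- Pointwise bound on a good cell pair: `W d² ≤ (κ−e)² W + η K d²` whenever `W ≤ K`, `K ≥ 0`,
`(κ−e)² ≤ d² ≤ (κ+e)² ≤ (1+η)(κ−e)²`. -/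
theorem pointwise_good {W K d κ e η : ℝ} (hWK : W ≤ K) (hK : 0 ≤ K) (hη : 0 ≤ η)
    (hlo : (κ - e) ^ 2 ≤ d ^ 2) (hhi : d ^ 2 ≤ (κ + e) ^ 2)
    (hratio : (κ + e) ^ 2 ≤ (1 + η) * (κ - e) ^ 2) :
    W * d ^ 2 ≤ (κ - e) ^ 2 * W + η * (K * d ^ 2) := by
  rcases le_or_gt 0 W with hW | hW
  · have h1 : W * d ^ 2 ≤ W * ((1 + η) * (κ - e) ^ 2) :=
      mul_le_mul_of_nonneg_left (hhi.trans hratio) hW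
    have h2 : W * (κ - e) ^ 2 ≤ K * d ^ 2 := mul_le_mul hWK hlo (sq_nonneg _) hK
    nlinarith
  · have h1 : W * d ^ 2 ≤ W * (κ - e) ^ 2 := mul_le_mul_of_nonpos_left hlo hW.le
    have h2 : 0 ≤ η * (K * d ^ 2) := by positivity
    nlinarith

/-- Pointwise bound on a garbage cell pair: `W d² ≤ τ K` whenever `W ≤ K`, `K ≥ 0`, `d² ≤ (κ+e)² ≤ τ`. -/
theorem pointwise_garbage {W K d κ e τ : ℝ} (hWK : W ≤ K) (hK : 0 ≤ K)
    (hhi : d ^ 2 ≤ (κ + e) ^ 2) (hτ : (κ + e) ^ 2 ≤ τ) : W * d ^ 2 ≤ τ * K := by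
  have h1 : W * d ^ 2 ≤ K * d ^ 2 := mul_le_mul_of_nonneg_right hWK (sq_nonneg _)
  have h2 : K * d ^ 2 ≤ K * τ := mul_le_mul_of_nonneg_left (hhi.trans hτ) hK
  linarith [mul_comm K τ]

omit [Fintype α] [Fintype β] in
/-- **One cell pair.** On a rectangle `X × Y` on which `|d|` is within `e` of a constant `κ ≥ 0`
(`κ − e ≤ |d| ≤ κ + e`), with `d² ≤ 1`, weights `W ≤ K`, `K ≥ 0`, `Σ_{X×Y} W ≤ θ₀` (`θ₀ ≥ 0`):
`Σ_{X×Y} W d² ≤ θ₀ + η Σ_{X×Y} K d² + τ Σ_{X×Y} K` for any `τ ≥ ((6/η+2)e)²`, `0 < η ≤ 1`. -/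
theorem rect_bound (W K d : α → β → ℝ) (X : Finset α) (Y : Finset β) (κ e η τ θ₀ : ℝ)
    (hWK : ∀ x y, W x y ≤ K x y) (hK : ∀ x y, 0 ≤ K x y) (hη : 0 < η) (hη1 : η ≤ 1)
    (he : 0 ≤ e) (hθ : 0 ≤ θ₀) (hrect : ∑ x ∈ X, ∑ y ∈ Y, W x y ≤ θ₀) (hκ : 0 ≤ κ)
    (hlo : ∀ x ∈ X, ∀ y ∈ Y, κ - e ≤ |d x y|) (hhi : ∀ x ∈ X, ∀ y ∈ Y, |d x y| ≤ κ + e)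
    (hd1 : ∀ x y, d x y ^ 2 ≤ 1) (hτ : ((6 / η + 2) * e) ^ 2 ≤ τ) :
    ∑ x ∈ X, ∑ y ∈ Y, W x y * d x y ^ 2 ≤
      θ₀ + η * ∑ x ∈ X, ∑ y ∈ Y, K x y * d x y ^ 2 + τ * ∑ x ∈ X, ∑ y ∈ Y, K x y := by
  have hKd : 0 ≤ ∑ x ∈ X, ∑ y ∈ Y, K x y * d x y ^ 2 :=
    sum_nonneg fun x _ => sum_nonneg fun y _ => mul_nonneg (hK x y) (sq_nonneg _)
  have hKs : 0 ≤ ∑ x ∈ X, ∑ y ∈ Y, K x y := sum_nonneg fun x _ => sum_nonneg fun y _ => hK x y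
  have hτ0 : 0 ≤ τ := le_trans (sq_nonneg _) hτ
  -- `d² ≤ (κ + e)²` everywhere on the rectangle
  have hhi2 : ∀ x ∈ X, ∀ y ∈ Y, d x y ^ 2 ≤ (κ + e) ^ 2 := by
    intro x hx y hy
    have h1 := hhi x hx y hy
    have h0 : 0 ≤ |d x y| := abs_nonneg _
    rw [← sq_abs (d x y)]
    exact pow_le_pow_left₀ h0 h1 2
  by_cases hgood : (6 / η + 1) * e ≤ κ
  · -- GOOD cell pair: multiplicative sandwich
    obtain ⟨hκe, hratio⟩ := good_cell hη hη1 he hgood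
    have hlo2 : ∀ x ∈ X, ∀ y ∈ Y, (κ - e) ^ 2 ≤ d x y ^ 2 := by
      intro x hx y hy
      rw [← sq_abs (d x y)]
      exact pow_le_pow_left₀ hκe (hlo x hx y hy) 2
    have hpt : ∀ x ∈ X, ∀ y ∈ Y,
        W x y * d x y ^ 2 ≤ (κ - e) ^ 2 * W x y + η * (K x y * d x y ^ 2) :=
      fun x hx y hy => pointwise_good (hWK x y) (hK x y) hη.le (hlo2 x hx y hy) (hhi2 x hx y hy) hratio
    have hsum : ∑ x ∈ X, ∑ y ∈ Y, W x y * d x y ^ 2 ≤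
        (κ - e) ^ 2 * ∑ x ∈ X, ∑ y ∈ Y, W x y + η * ∑ x ∈ X, ∑ y ∈ Y, K x y * d x y ^ 2 := by
      calc ∑ x ∈ X, ∑ y ∈ Y, W x y * d x y ^ 2
          ≤ ∑ x ∈ X, ∑ y ∈ Y, ((κ - e) ^ 2 * W x y + η * (K x y * d x y ^ 2)) :=
            sum_le_sum fun x hx => sum_le_sum fun y hy => hpt x hx y hy
        _ = (κ - e) ^ 2 * ∑ x ∈ X, ∑ y ∈ Y, W x y + η * ∑ x ∈ X, ∑ y ∈ Y, K x y * d x y ^ 2 := by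
            simp only [sum_add_distrib, mul_sum]
    -- `(κ - e)² ≤ 1` if the rectangle is nonempty; otherwise everything vanishes
    rcases (X ×ˢ Y).eq_empty_or_nonempty with hempty | hne
    · have hXY : ∀ (F : α → β → ℝ), ∑ x ∈ X, ∑ y ∈ Y, F x y = 0 := by
        intro F
        rw [← sum_product' (f := fun x y => F x y), hempty, sum_empty]
      rw [hXY, hXY, hXY]
      linarith
    · obtain ⟨p, hp⟩ := hne
      rw [mem_product] at hp
      have h1 : (κ - e) ^ 2 ≤ 1 := (hlo2 p.1 hp.1 p.2 hp.2).trans (hd1 p.1 p.2)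
      have h2 : (κ - e) ^ 2 * ∑ x ∈ X, ∑ y ∈ Y, W x y ≤ θ₀ := by
        calc (κ - e) ^ 2 * ∑ x ∈ X, ∑ y ∈ Y, W x y ≤ (κ - e) ^ 2 * θ₀ :=
              mul_le_mul_of_nonneg_left hrect (sq_nonneg _)
          _ ≤ 1 * θ₀ := mul_le_mul_of_nonneg_right h1 hθ
          _ = θ₀ := one_mul θ₀
      nlinarith [mul_nonneg hτ0 hKs]
  · -- GARBAGE cell pair: uniformly small entries
    push Not at hgood
    have hτ' : (κ + e) ^ 2 ≤ τ := by
      refine le_trans ?_ hτ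
      have h1 : κ + e ≤ (6 / η + 2) * e := by nlinarith
      have h0 : 0 ≤ κ + e := by linarith
      exact pow_le_pow_left₀ h0 h1 2
    have hpt : ∀ x ∈ X, ∀ y ∈ Y, W x y * d x y ^ 2 ≤ τ * K x y :=
      fun x hx y hy => pointwise_garbage (hWK x y) (hK x y) (hhi2 x hx y hy) hτ'
    have hsum : ∑ x ∈ X, ∑ y ∈ Y, W x y * d x y ^ 2 ≤ τ * ∑ x ∈ X, ∑ y ∈ Y, K x y := by
      calc ∑ x ∈ X, ∑ y ∈ Y, W x y * d x y ^ 2 ≤ ∑ x ∈ X, ∑ y ∈ Y, τ * K x y :=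
            sum_le_sum fun x hx => sum_le_sum fun y hy => hpt x hx y hy
        _ = τ * ∑ x ∈ X, ∑ y ∈ Y, K x y := by simp only [mul_sum]
    nlinarith [mul_nonneg hη.le hKd]

/-- Fiberwise decomposition of a double sum along cell maps into boxes. -/
theorem sum_sum_cells (F : α → β → ℝ) (cA : α → γ) (cB : β → γ') (BoxA : Finset γ)
    (BoxB : Finset γ') (hA : ∀ x, cA x ∈ BoxA) (hB : ∀ y, cB y ∈ BoxB) :
    ∑ x, ∑ y, F x y = ∑ i ∈ BoxA, ∑ j ∈ BoxB,
      ∑ x ∈ univ.filter (fun x => cA x = i), ∑ y ∈ univ.filter (fun y => cB y = j), F x y := by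
  rw [← sum_fiberwise_of_maps_to (s := univ) (t := BoxA) (g := cA) (fun x _ => hA x)]
  refine sum_congr rfl fun i _ => ?_
  have inner : ∀ x, ∑ y, F x y = ∑ j ∈ BoxB, ∑ y ∈ univ.filter (fun y => cB y = j), F x y :=
    fun x => (sum_fiberwise_of_maps_to (s := univ) (t := BoxB) (g := cB) (fun y _ => hB y) _).symm
  simp_rw [inner]
  exact sum_comm

/-- **All cell pairs.** If the pairs `(x, y)` are grouped by cells `cA x ∈ BoxA`, `cB y ∈ BoxB` so that
`|d x y|` is within `e` of a constant `κ (cA x) (cB y) ≥ 0`, `d² ≤ 1`, `W ≤ K`, `K ≥ 0`, and every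
rectangle sum of `W` is `≤ θ₀` (`θ₀ ≥ 0`), then for `0 < η ≤ 1` and `τ ≥ ((6/η+2)e)²`:
`Σ W d² ≤ |BoxA|·|BoxB|·θ₀ + η Σ K d² + τ Σ K`. -/
theorem cells_bound (W K d : α → β → ℝ) (cA : α → γ) (cB : β → γ') (BoxA : Finset γ)
    (BoxB : Finset γ') (κ : γ → γ' → ℝ) (e η τ θ₀ : ℝ)
    (hA : ∀ x, cA x ∈ BoxA) (hB : ∀ y, cB y ∈ BoxB)
    (hWK : ∀ x y, W x y ≤ K x y) (hK : ∀ x y, 0 ≤ K x y) (hη : 0 < η) (hη1 : η ≤ 1)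
    (he : 0 ≤ e) (hθ : 0 ≤ θ₀)
    (hrect : ∀ (X : Finset α) (Y : Finset β), ∑ x ∈ X, ∑ y ∈ Y, W x y ≤ θ₀)
    (hκ : ∀ i j, 0 ≤ κ i j)
    (hlo : ∀ x y, κ (cA x) (cB y) - e ≤ |d x y|) (hhi : ∀ x y, |d x y| ≤ κ (cA x) (cB y) + e)
    (hd1 : ∀ x y, d x y ^ 2 ≤ 1) (hτ : ((6 / η + 2) * e) ^ 2 ≤ τ) :
    ∑ x, ∑ y, W x y * d x y ^ 2 ≤
      (BoxA.card * BoxB.card) * θ₀ + η * ∑ x, ∑ y, K x y * d x y ^ 2 + τ * ∑ x, ∑ y, K x y := by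
  rw [sum_sum_cells (fun x y => W x y * d x y ^ 2) cA cB BoxA BoxB hA hB,
    sum_sum_cells (fun x y => K x y * d x y ^ 2) cA cB BoxA BoxB hA hB,
    sum_sum_cells K cA cB BoxA BoxB hA hB]
  have hcell : ∀ i ∈ BoxA, ∀ j ∈ BoxB,
      ∑ x ∈ univ.filter (fun x => cA x = i), ∑ y ∈ univ.filter (fun y => cB y = j),
          W x y * d x y ^ 2 ≤
        θ₀ + η * ∑ x ∈ univ.filter (fun x => cA x = i), ∑ y ∈ univ.filter (fun y => cB y = j),
            K x y * d x y ^ 2 +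
          τ * ∑ x ∈ univ.filter (fun x => cA x = i), ∑ y ∈ univ.filter (fun y => cB y = j),
            K x y := by
    intro i _ j _
    refine rect_bound W K d _ _ (κ i j) e η τ θ₀ hWK hK hη hη1 he hθ (hrect _ _) (hκ i j)
      ?_ ?_ hd1 hτ
    · intro x hx y hy
      rw [mem_filter] at hx hy
      rw [← hx.2, ← hy.2]
      exact hlo x y
    · intro x hx y hy
      rw [mem_filter] at hx hy
      rw [← hx.2, ← hy.2]
      exact hhi x y
  calc _ ≤ ∑ i ∈ BoxA, ∑ j ∈ BoxB,
        (θ₀ + η * ∑ x ∈ univ.filter (fun x => cA x = i), ∑ y ∈ univ.filter (fun y => cB y = j),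
            K x y * d x y ^ 2 +
          τ * ∑ x ∈ univ.filter (fun x => cA x = i), ∑ y ∈ univ.filter (fun y => cB y = j),
            K x y) := sum_le_sum fun i hi => sum_le_sum fun j hj => hcell i hi j hj
    _ = _ := by
        simp only [sum_add_distrib, sum_const, ← mul_sum]
        ring

end Cells

end Summit.PneNP.PneNP.Theorems.SmallBlockRothvossBallGrid

end
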